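import Summits.BirchSwinnertonDyer.BirchSwinnertonDyer.Theorems.SignedLowerHalvesSmallImageLowerHalfBothSignsRttCharRoadLocalShape
import Literature.NumberTheory.GaloisRepresentations.DeRhamLAdicCharacterHeckeReduction
import Literature.NumberTheory.GaloisRepresentations.LAdicCharacterUnramifiedAEProofs
import HarnessLib

/-!
# Route `SignedLowerHalves`, crux L `SmallImageLowerHalfBothSigns` (stmt-BirchSwinnertonDyer-23599), line `rtt_w3` — brick J-char′ of the
# «ROAD-𝔪» repair: the integral pinned character `θ = ψ_𝔭` of JD-b is RAMIFIED at every prime of a SHARP modulus away from `p`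

INPUTS hand `bsd-inputs-honda-p1` g32 under LEAD `cruxlead-stmt-BirchSwinnertonDyer-23599` (BRIEF-ROADGAP-g15 §3(c): JD′); helper
`--supports stmt-BirchSwinnertonDyer-23599`; THEOREMS ONLY, no `sorry`; additive successor of `…RttCharRoadLocalShape` (honda g18; not edited).
Closes nothing; BSD / crux L / JD / S4‴ are NOT proved by this.

WHY. The frame of S4‴ (`stub_charRoadFrame_ns_of₆`, honda g31) takes the ROAD INPUT `hθram`: «`θ` ramified at every `w ∣ 𝔪`, `w ∤ p`» for the
avatar `θ` of the theta partner's Grössencharakter `ψ mod 𝔪`, built in JD-b/J-char as the integral framing of Weil's character of the idelic lift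
`ω` of `ψ⁻¹` (`exists_integralPinnedCharacter_localShape_of_isGrossencharakter`). For an IMPRIMITIVE `𝔪` this is false; the producer′
(`SmallImageLambdaLowerThreeNsThetaPartner.exists_arithmeticHalf_classwide_sharp`, honda g32) now exports the partner with a SHARP modulus:
(prim′) `∀ χ : HeckeCharacter K, (∀ᶠ v, χ(ϖ_v) = ψ v) → ∀ w, 𝔪 ≤ w.asIdeal ↔ ¬ χ.IsUnramifiedAt w`. This file turns (prim′) into `hθram`:

* ★ `exists_integralPinnedCharacter_localShape_ram_of_isGrossencharakter` — J-char (`…_localShape_of_isGrossencharakter`) VERBATIM (same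
  `S`, `θ`, clauses (i) pin off `p·𝔪`, (ii) local shape above `p`) under the extra hypothesis (prim′), with the NEW clause
  (iii) `∀ w, 𝔪 ≤ w.asIdeal → p ∉ w → ∃ 𝔓 ∈ w.primesAbove, ∃ τ ∈ 𝔓.inertia Γ_K, (θ τ)₀₀ ≠ 1` — EXACTLY the binder `hθram` of
  `stub_charRoadFrame_ns_of₆`. Proof of (iii): `ω⁻¹` realises `ψ`, so by (prim′) `ω` is ramified at `w`: some unit `u ∈ 𝒪_wˣ` has `ω(⟨u⟩_w) ≠ 1`;
  `u = Art(g)` for `g` in the inertia of `W_{K_w}` (`exists_inertia_canonicalArtin_eq`, clause `image_inertia` of THE local Artin map); the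
  local shape of Weil's character at EVERY place (`det_weilRep_toAbsGalois`, Serre III §2.3 / local–global compatibility of class field
  theory) gives `r(res g) = ψ_ℓ(⟨u⟩_w) = e⁻¹(ω(⟨u⟩_w)) ≠ 1` (`w ∤ p`); `res g ∈ I_{K_w}` (`WeilGroup.mem_inertia_iff`); and unramifiedness
  at `w` is local (`GaloisRep.isUnramifiedAt_iff_toLocal_holds`, Neukirch II (9.6)): were every `I_𝔓`, `𝔓 ∣ w`, killed by `θ` (= `r` after
  the injective change of coefficients `𝒪_{ℚ_p(S)} ⊆ ℚ̄_p`), `r` would kill `I_{K_w}`.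
* `exists_integralPinnedCharacter_localShape_embType_ram` — the consumer's `embType` currency (`…_localShape_embType` VERBATIM + (iii)),
  for JD′ = `charRoadJD_of_curveSide` with `hθram` threaded.

References: [SerreAbelianLadic1968] Ch. III §2.3; [NeukirchANT1999] Ch. II §9 Prop. (9.6), Ch. VI §5 Prop. (5.6), Ch. VII §6 (6.11)–(6.14);
[SerreLocalFields1979] Ch. XIII §4 Thm. 1; [Weil1956] §1.
-/

set_option autoImplicit false
-- D-0017: single-problem summit, the namespace repeats the problem name by design.
set_option linter.dupNamespace false
noncomputable section

open scoped NumberField MatrixGroups Topology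
open NumberField IsDedekindDomain Polynomial Field Filter
  Literature.NumberTheory.GaloisRepresentations Literature.NumberTheory.LFunctions
  Literature.NumberTheory.EllipticCurves

namespace Summit.BirchSwinnertonDyer.BirchSwinnertonDyer.Theorems.SmallImageRttCharRoad

section Ram

variable {K : Type} [Field K] [NumberField K] {p : ℕ} [Fact p.Prime]

/-- ★ **J-char′: the integral pinned character is RAMIFIED at every prime of a sharp modulus away from `p`.** For a Grössencharakter
`ψ mod 𝔪` (`𝔪 ≠ 0`, type `(a, b)`) whose modulus is SHARP — (prim′) the primes of `𝔪` are exactly the ramified places of every Hecke character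
realising `ψ` — and `e : ℚ̄_p ≃ ℂ`: there are `S` (`0 < [ℚ_p(S):ℚ_p]`) and an integral `θ : Γ_K → GL₁(𝒪_{ℚ_p(S)})` with (i) the pin off `p·𝔪` and
(ii) the local shape above `p` of `exists_integralPinnedCharacter_localShape_of_isGrossencharakter` VERBATIM, and (iii) for every prime
`w ⊇ 𝔪` with `p ∉ w` an inertia element `τ ∈ I_𝔓`, `𝔓 ∣ w`, with `θ(τ)₀₀ ≠ 1`. See the module docstring for the proof of (iii).
[cite: SerreAbelianLadic1968, Ch. III §2.3] [cite: NeukirchANT1999, Ch. II §9 Prop. (9.6), Ch. VII §6 Cor. (6.14)] [cite: SerreLocalFields1979, Ch. XIII §4 Thm. 1] -/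
theorem exists_integralPinnedCharacter_localShape_ram_of_isGrossencharakter {𝔪 : Ideal (𝓞 K)}
    (h𝔪 : 𝔪 ≠ ⊥) {a b : InfinitePlace K → ℤ} {ψ : HeightOneSpectrum (𝓞 K) → ℂ} (hψ : IsGrossencharakter 𝔪 a b ψ)
    (hsharp : ∀ χ : HeckeCharacter K, (∀ᶠ v in cofinite, χ.valueAtUniformizer v = ψ v) →
      ∀ w : HeightOneSpectrum (𝓞 K), 𝔪 ≤ w.asIdeal ↔ ¬ χ.IsUnramifiedAt w)
    (e : PadicAlgCl p ≃+* ℂ) :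
    ∃ S : Set (PadicAlgCl p), 0 < Module.finrank ℚ_[p] (padicCoeffField S) ∧
      ∃ θ : FramedGaloisRep K (padicCoeffIntegers S) 1,
        (∀ v : HeightOneSpectrum (𝓞 K), ((p : ℕ) : 𝓞 K) ∉ v.asIdeal → ¬ 𝔪 ≤ v.asIdeal →
          θ.IsUnramifiedAt v ∧ ∃ P : Polynomial (padicCoeffIntegers S),
            P.map (padicCoeffIntegers S).subtype = X - C (e.symm (ψ v)) ∧ θ.HasFrobCharpolyAt v P) ∧
        (∀ v : HeightOneSpectrum (𝓞 K), ((p : ℕ) : 𝓞 K) ∈ v.asIdeal → ¬ 𝔪 ≤ v.asIdeal →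
          ∀ (art : WeilGroup (v.adicCompletion K) →* (v.adicCompletion K)ˣ), IsLocalArtinMap (v.adicCompletion K) art →
          ∀ w : WeilGroup (v.adicCompletion K),
            ((((θ (absGaloisRestrict K (v.adicCompletion K) (WeilGroup.toAbsGalois (v.adicCompletion K) w)) :
                GL (Fin 1) (padicCoeffIntegers S)) : Matrix (Fin 1) (Fin 1) (padicCoeffIntegers S)) 0 0 : padicCoeffIntegers S) :
                PadicAlgCl p) =
              e.symm (ψ v) ^ (WeilGroup.deg w) *
                ∏ f : {f : v.adicCompletion K →+* PadicAlgCl p // Continuous f},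
                  f.1 ((art w : (v.adicCompletion K)ˣ) : v.adicCompletion K) ^
                    (HeckeCharacter.embExponent a b
                      ((e : PadicAlgCl p →+* ℂ).comp (f.1.comp (algebraMap K (v.adicCompletion K)))))) ∧
        (∀ w : HeightOneSpectrum (𝓞 K), 𝔪 ≤ w.asIdeal → ((p : ℕ) : 𝓞 K) ∉ w.asIdeal →
          ∃ 𝔓 ∈ w.primesAbove, ∃ τ ∈ 𝔓.inertia (absoluteGaloisGroup K),
            ((θ τ : GL (Fin 1) (padicCoeffIntegers S)) : Matrix (Fin 1) (Fin 1) (padicCoeffIntegers S)) 0 0 ≠ 1) := by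
  haveI : CompactSpace (absoluteGaloisGroup K) := absoluteGaloisGroup_compactSpace K
  -- `ψ⁻¹` is a Grössencharakter mod `𝔪` of type `(-a, -b)`
  have hpow : ∀ I : Ideal (𝓞 K), idealPow K (fun v => (ψ v)⁻¹) I = (idealPow K ψ I)⁻¹ := fun I => by
    rw [idealPow, idealPow, ← finprod_inv_distrib]
    exact finprod_congr fun v => inv_pow _ _
  have hinv : IsGrossencharakter 𝔪 (fun w => -a w) (fun w => -b w) (fun v => (ψ v)⁻¹) := by
    refine ⟨fun v hv => inv_ne_zero (hψ.ne_zero v hv), fun c d hc hd hcop hcd hpos => ?_⟩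
    rw [hpow, hpow, hψ.idealPow_span_eq c d hc hd hcop hcd hpos, mul_inv, ← Finset.prod_inv_distrib]
    refine congrArg _ (Finset.prod_congr rfl fun w _ => ?_)
    rw [mul_inv, zpow_neg, zpow_neg]
  -- the idelic lift `ω` of `ψ⁻¹`, its module of definition, Weil's character `r = weilRep`
  obtain ⟨ω, hinf, hω⟩ := HeckeCharacter.exists_of_isGrossencharakter h𝔪 hinv
  obtain ⟨ex, hmod⟩ := ω.exists_isModulus_of_ramified
  set T := (HeckeCharacter.finite_ramifiedPlaces_holds ω).toFinset with hT
  have hTunr : ∀ w : HeightOneSpectrum (𝓞 K), w ∉ T → ω.IsUnramifiedAt w := fun w hw => by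
    by_contra hh
    exact hw ((HeckeCharacter.finite_ramifiedPlaces_holds ω).mem_toFinset.mpr hh)
  set S := HeckeCharacter.lAdicValueGens ω e T ex with hS
  haveI hfd : FiniteDimensional ℚ_[p] (padicCoeffField S) := HeckeCharacter.finiteDimensional_lAdicValueField ω e T ex
  -- the values of Weil's character lie in the (closed) field of values
  have hclosed : IsClosed ((padicCoeffField S : IntermediateField ℚ_[p] (PadicAlgCl p)) : Set (PadicAlgCl p)) :=
    (HeckeCharacter.isComplete_lAdicValueField ω e T ex).isClosed
  have hval : ∀ σ : absoluteGaloisGroup K, hinf.weilValue hmod e σ ∈ padicCoeffField S := fun σ =>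
    hclosed.mem_of_tendsto (hinf.tendsto_rep hmod e σ) (Eventually.of_forall fun N => hinf.rep_mem hmod e N σ)
  have hmem : ∀ σ : absoluteGaloisGroup K,
      ((hinf.weilRep hmod e σ : GL (Fin 1) (PadicAlgCl p)) : Matrix (Fin 1) (Fin 1) (PadicAlgCl p)) 0 0 ∈ padicCoeffField S := fun σ => by
    rw [hinf.weilRep_apply_coe hmod e σ 0 0]
    exact inv_mem (hval σ)
  obtain ⟨θ, hθ⟩ := FramedRep.exists_baseChange_eq_of_forall_mem (hinf.weilRep hmod e) S hmem
  refine ⟨S, Module.finrank_pos, θ, fun v hvp hv => ?_, fun v hvp hv art hart w => ?_, fun w hw hwp => ?_⟩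
  · -- (i) JD-b verbatim
    obtain ⟨hunr, hvalv⟩ := hω v hv
    have hvT : v ∉ T := fun h => ((HeckeCharacter.finite_ramifiedPlaces_holds ω).mem_toFinset.mp h) hunr
    have h1 := hinf.isUnramifiedAt_weilRep hmod e hvT hvp
    have h2 := hinf.hasFrobCharpolyAt_weilRep hmod e hvT hvp
    rw [hvalv] at h2
    rw [← hθ] at h1 h2
    simp only [inv_inv] at h2
    refine ⟨(FramedGaloisRep.isUnramifiedAt_baseChange_iff _ _ Subtype.val_injective v θ).mp h1, ?_⟩
    obtain ⟨𝔓, h𝔓⟩ := IsDedekindDomain.HeightOneSpectrum.primesAbove_nonempty v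
    obtain ⟨Φ, hΦ⟩ := IsDedekindDomain.HeightOneSpectrum.exists_isArithFrobAt_of_mem_primesAbove_holds h𝔓
    have hentry := (FramedGaloisRep.hasFrobCharpolyAt_iff_of_rank_one _ v _).mp h2 𝔓 h𝔓 Φ hΦ
    rw [FramedRep.coe_baseChange_apply, Matrix.map_apply] at hentry
    refine ⟨X - C (((θ Φ : GL (Fin 1) (padicCoeffIntegers S)) : Matrix (Fin 1) (Fin 1) (padicCoeffIntegers S)) 0 0), ?_, ?_⟩
    · rw [Polynomial.map_sub, map_X, map_C, hentry]
    · refine (FramedGaloisRep.hasFrobCharpolyAt_baseChange_iff (padicCoeffIntegers S).subtype continuous_subtype_val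
        Subtype.val_injective v θ _).mp ?_
      rw [Polynomial.map_sub, map_X, map_C, hentry]
      exact h2
  · -- (ii) the local shape above `p`
    obtain ⟨hunr, hvalv⟩ := hω v hv
    have key := hinf.weilRep_toAbsGalois_apply hmod e hTunr hvp art hart w
    rw [← hθ, FramedRep.coe_baseChange_apply, Matrix.map_apply] at key
    rw [Subring.coe_subtype] at key
    rw [key, prod_zpow_neg_embExponent_neg e a b]
    congr 1
    -- `ω(⟨art w⟩_v) = ω(ϖ_v)^{-deg w} = (ψ v)^{deg w}`
    have hz : Valued.v ((art w : (v.adicCompletion K)ˣ) : v.adicCompletion K) = WithZero.exp (-(-WeilGroup.deg w)) := by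
      rw [neg_neg]; exact ArtinLocalGlobal.valued_artin_eq_exp_deg v hart w
    rw [hunr.coe_map_localUnits_eq_zpow (art w) hz, hvalv, map_zpow₀, map_inv₀, inv_zpow', neg_neg]
  · -- (iii) ramification at the primes of the sharp modulus away from `p`
    -- `ω⁻¹` realises `ψ`, so `ω` is ramified at `w` by (prim′)
    have hcof : ∀ᶠ v : HeightOneSpectrum (𝓞 K) in cofinite, ¬ 𝔪 ≤ v.asIdeal :=
      eventually_cofinite.mpr ((Ideal.finite_factors h𝔪).subset fun v hv => by
        by_contra hle; exact hv fun hle' => hle (Ideal.dvd_iff_le.mpr hle'))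
    have hreal : ∀ᶠ v : HeightOneSpectrum (𝓞 K) in cofinite, ω⁻¹.valueAtUniformizer v = ψ v := by
      filter_upwards [hcof] with v hv
      rw [HeckeCharacter.valueAtUniformizer_inv', (hω v hv).2, inv_inv]
    have hωram : ¬ ω.IsUnramifiedAt w := fun hunr => ((hsharp ω⁻¹ hreal w).mp hw) hunr.inv'
    -- a local unit on which `ω` is nontrivial
    obtain ⟨u, hu, hωu⟩ : ∃ u : (w.adicCompletion K)ˣ, Valued.v (u : w.adicCompletion K) = 1 ∧ ω (localUnits w u) ≠ 1 := by
      by_contra h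
      push Not at h
      exact hωram (HeckeCharacter.isUnramifiedAt_iff_forall_valued_eq_one.mpr h)
    -- `u = Art(g)` with `g` in the Weil inertia at `w`
    obtain ⟨g, hgI, hgu⟩ := exists_inertia_canonicalArtin_eq w hu
    set σ : absoluteGaloisGroup K :=
      absGaloisRestrict K (w.adicCompletion K) (WeilGroup.toAbsGalois (w.adicCompletion K) g) with hσdef
    -- the local shape of Weil's character at `w ∤ p`: `r(σ)₀₀ = e⁻¹(ω(⟨u⟩_w)) ≠ 1`
    have hdet := hinf.det_weilRep_toAbsGalois hmod e hTunr w (canonicalArtin (w.adicCompletion K))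
      (isLocalArtinMap_canonicalArtin_holds (w.adicCompletion K)) g
    have hdet' := congrArg (fun x : (PadicAlgCl p)ˣ => (x : PadicAlgCl p)) hdet
    simp only [FramedRep.det_apply, Matrix.GeneralLinearGroup.val_det_apply, Matrix.det_fin_one] at hdet'
    rw [hgu, hinf.lAdicAvatar_apply, HeckeCharacter.coe_lAdicAvatarHom_localUnits_of_not_mem e hwp] at hdet'
    have hne : hinf.weilRep hmod e σ ≠ 1 := by
      intro h1
      rw [← hσdef, h1] at hdet'
      simp only [Units.val_one, Matrix.one_apply_eq] at hdet'
      have h2 : (ω (localUnits w u) : ℂ) = 1 := by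
        have := congrArg e hdet'.symm
        rwa [RingEquiv.apply_symm_apply, map_one] at this
      exact hωu (Units.val_eq_one.mp h2)
    -- were `θ` unramified at `w`, `r` would kill the local inertia, in particular `σ`
    by_contra hcon
    push Not at hcon
    have hθunr : FramedGaloisRep.IsUnramifiedAt w θ := fun 𝔓 h𝔓 τ hτ => by
      refine Units.ext (Matrix.ext fun i j => ?_)
      rw [Subsingleton.elim i 0, Subsingleton.elim j 0, hcon 𝔓 h𝔓 τ hτ, Units.val_one, Matrix.one_apply_eq]
    have hrunr : (hinf.weilRep hmod e).IsUnramifiedAt w := by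
      rw [← hθ]
      exact (FramedGaloisRep.isUnramifiedAt_baseChange_iff _ _ Subtype.val_injective w θ).mpr hθunr
    have hloc := (GaloisRep.isUnramifiedAt_iff_toLocal_holds w (hinf.weilRep hmod e).toGaloisRep).mp
      (((hinf.weilRep hmod e).isUnramifiedAt_toGaloisRep_iff w).mpr hrunr) _ (WeilGroup.mem_inertia_iff.mp hgI)
    rw [GaloisRep.toLocal_apply] at hloc
    exact hne ((FramedRep.toContinuousRep_apply_eq_one_iff _ _).mp hloc)

end Ram

/-! ## The consumer's `embType` currency -/

section EmbType

variable {K : Type} [Field K] [NumberField K] {p : ℕ} [Fact p.Prime]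

/-- **J-char′ in the `embType` currency of JD** (`exists_integralPinnedCharacter_localShape_embType` VERBATIM + (iii)): for `K` totally complex and
`ψ mod 𝔪` of type `(embType σK, embTypeConj σK)` with a SHARP modulus (prim′), there are `S`, `θ` with the pin off `p·𝔪`, the local shape
`θ(res w)₀₀ = e⁻¹(ψ v)^{deg w} · f₀(art w)` above `p`, AND `θ` ramified at every `w ⊇ 𝔪`, `w ∌ p` (the binder `hθram` of `stub_charRoadFrame_ns_of₆`).
[cite: SerreAbelianLadic1968, Ch. III §2.3] [cite: NeukirchANT1999, Ch. II §9 Prop. (9.6), Ch. VII §6 Cor. (6.14)] -/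
theorem exists_integralPinnedCharacter_localShape_embType_ram [IsTotallyComplex K] {𝔪 : Ideal (𝓞 K)} (h𝔪 : 𝔪 ≠ ⊥)
    (σK : K →+* ℂ) {ψ : HeightOneSpectrum (𝓞 K) → ℂ} (hψ : IsGrossencharakter 𝔪 (embType σK) (embTypeConj σK) ψ)
    (hsharp : ∀ χ : HeckeCharacter K, (∀ᶠ v in cofinite, χ.valueAtUniformizer v = ψ v) →
      ∀ w : HeightOneSpectrum (𝓞 K), 𝔪 ≤ w.asIdeal ↔ ¬ χ.IsUnramifiedAt w)
    (e : PadicAlgCl p ≃+* ℂ) :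
    ∃ S : Set (PadicAlgCl p), 0 < Module.finrank ℚ_[p] (padicCoeffField S) ∧
      ∃ θ : FramedGaloisRep K (padicCoeffIntegers S) 1,
        (∀ v : HeightOneSpectrum (𝓞 K), ((p : ℕ) : 𝓞 K) ∉ v.asIdeal → ¬ 𝔪 ≤ v.asIdeal →
          θ.IsUnramifiedAt v ∧ ∃ P : Polynomial (padicCoeffIntegers S),
            P.map (padicCoeffIntegers S).subtype = X - C (e.symm (ψ v)) ∧ θ.HasFrobCharpolyAt v P) ∧
        (∀ v : HeightOneSpectrum (𝓞 K), ((p : ℕ) : 𝓞 K) ∈ v.asIdeal → ¬ 𝔪 ≤ v.asIdeal →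
          ∀ (f₀ : v.adicCompletion K →+* PadicAlgCl p), Continuous f₀ →
            (e : PadicAlgCl p →+* ℂ).comp (f₀.comp (algebraMap K (v.adicCompletion K))) = σK →
          ∀ (art : WeilGroup (v.adicCompletion K) →* (v.adicCompletion K)ˣ), IsLocalArtinMap (v.adicCompletion K) art →
          ∀ w : WeilGroup (v.adicCompletion K),
            ((((θ (resGalOfEmb (closureEmb (K := K) (v.adicCompletion K)) (WeilGroup.toAbsGalois (v.adicCompletion K) w)) :
                GL (Fin 1) (padicCoeffIntegers S)) : Matrix (Fin 1) (Fin 1) (padicCoeffIntegers S)) 0 0 : padicCoeffIntegers S) :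
                PadicAlgCl p) =
              e.symm (ψ v) ^ (WeilGroup.deg w) * f₀ ((art w : (v.adicCompletion K)ˣ) : v.adicCompletion K)) ∧
        (∀ w : HeightOneSpectrum (𝓞 K), 𝔪 ≤ w.asIdeal → ((p : ℕ) : 𝓞 K) ∉ w.asIdeal →
          ∃ 𝔓 ∈ w.primesAbove, ∃ τ ∈ 𝔓.inertia (absoluteGaloisGroup K),
            ((θ τ : GL (Fin 1) (padicCoeffIntegers S)) : Matrix (Fin 1) (Fin 1) (padicCoeffIntegers S)) 0 0 ≠ 1) := by
  obtain ⟨S, hS, θ, hpin, hloc, hram⟩ := exists_integralPinnedCharacter_localShape_ram_of_isGrossencharakter h𝔪 hψ hsharp e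
  refine ⟨S, hS, θ, hpin, fun v hvp hv f₀ hf₀ hf₀σ art hart w => ?_, hram⟩
  rw [resGalOfEmb_closureEmb_eq_absGaloisRestrict, hloc v hvp hv art hart w, prod_zpow_embExponent_embType_eq e σK hf₀ hf₀σ]

end EmbType

end Summit.BirchSwinnertonDyer.BirchSwinnertonDyer.Theorems.SmallImageRttCharRoad

end
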